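import Literature.MathematicalPhysics.QuantumFieldTheory.Balaban1983to89.B9Eq3153FrakGkBoundSlotDiagonal
import Literature.MathematicalPhysics.QuantumFieldTheory.Balaban1983to89.B9Eq3126H1LipschitzEnergy

/-!
# `Balaban1983to89.B9Eq3126H1kLipschitzSlotDiagonal` — T. Bałaban, *Propagators for lattice gauge theories in a background field*, Commun. Math. Phys. **99**
# (1985) 389–434 [Balaban1985BackgroundPropagators] (3.126) p. 420 *«HB = GQ*(QGQ*)⁻¹B»*, (3.130) p. 421, (3.122) p. 420, Thm 3.11 p. 416, with [Balaban1985Variational]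
# (45)–(46) p. 285, ON PRINT's DIAGONAL `ηL^{n+1} = 1`: **THE `k`-TH-STEP MINIMISER `H̃_{1,k}` OF A HESSIAN-SLOT PERTURBATION DIFFERS FROM THE CHAIN's `H_{1,k}` BY `O(θ)`
# IN THE FLAT ENERGY NORM** — `‖P(H̃_{1,k}b − H_{1,k}b)‖ ≤ C·√C_K·θ·‖b‖` for `P ∈ {1, curl₁, div₁}`, ANY slot `Δ₁` with `N₁`-form defect `θ ≤ γ₁∕2` against
# `Δ^η(U)`, the chain's `K⁻¹`-letter `C_K` at `U` DISPLAYED; for `Δ₁ := π_k†Δ^ηπ_k` this is print's `H` of (3.126) against the chain's `G₀`-proxy, step (iv-H)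
# of the row OWNER t4-ne9-p1's plan v7 «the Δ_π port» (O-ne9p1-g87-3, GO to leaf-03)

statement-level skeleton of published theorems with citation tags; proofs where landed; nothing here is a claim about the Yang–Mills mass gap

CITATION HEADER (lean-in-tree rule).  Audit cell `pub-balaban`, sub-cell `t4`, BINDER row NE9; filed by NE9 crux-team (2) leaf prover 03
(`b2b-balaban-t4-ne9-formalise-leaf-03`, gen 67), INTENT I-ne9leaf03-g67-F (the OWNER's W-8 (γ) «O-3: GO, YOURS (leaf-03 g67) … statement-first, abstract in
the slot on the diagonal class, the K-floor letter C_K DISPLAYED»).  Sources READ in the held text `paper:balaban1985-cmp99-background-propagators` (journal page =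
PDF page + 388) pp. 416, 419–421; [Balaban1985Variational] (45)–(46) through the tree's quotations.  Objects BY NAME: `laplaceAk`, `QkW`, `RofUk`, `hessOp`,
`laplaceALatticeK`, `H1LatticeK`, `KinvLatticeK`, `covCurlL2K`, `covDivL2K`; nothing re-declared, 0 `def`.

THE PRINT (verbatim).  p. 420: *«HB = GQ*(QGQ*)⁻¹B (3.126) … It differs from the operator investigated in previous sections by the additional term Δ′_π, but we
will prove that this term is a small perturbation of Δ_a»*; p. 421: *«G₀ = (Δ + DRD* + Q*aQ)⁻¹ … G = G₀(I − Δ′_πG₀)⁻¹ (3.130)»*; [B11] p. 285: *«H … giving a minimum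
of the quadratic form ½⟨A, ΔA⟩ under the restrictions L^jηQ_jA = B»*.

WHY THIS FILE (cell context).  DIAGNOSIS D-ne9p1-g87-1: print's `H` (3.126) is built on `G̃ = (Δ_π + DRD* + Q*aQ)⁻¹`, the chain's `H_{1,k}` on `G₀`.  The OWNER's
INTENT-5 gives `G̃ − G₀ = O(θ)` in the energy norm; this file is the `H`-row: the abstract `B9Eq3126H1LipschitzEnergy.norm_apply_H1K_sub_le` at the two structures
`T⁰ = Δ_{a,k}(U)` (the chain) and `T¹ = Δ₁ + D_UR_kD*_U + Q_k*aQ_k` (the slot), which share `Q_k(U)`: the averaging defect `δ_Q` is ZERO, so the `K̃⁻¹`-letter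
`C₁` of the perturbed operator multiplies zero and is inhabited by the finite-dimensional operator norm — NO K-floor at `Δ̃` (located note L-ne9leaf03g67-1, ADOPTED
by the OWNER W-8 (β)).  What survives: `γ = γ₁∕2` (`B9Eq3153FrakGkBoundSlotDiagonal` §1 (i)), `γ₀ = γ₁′` (the bare letters), `Θ = θ`, and the chain's `C_K` at `U`.

WHAT IS PROVED (sorry-free; proof lane — 0 `def`; [folklore] composition BY NAME + one operator-norm witness).
* **`exists_norm_H1k_slot_sub_le_diagonal`** — `∃ α₀ γ₁ C > 0` BEFORE `∀ n η (ηL^{n+1} = 1) c₀ c₁ (c₀(L^{n+1})^d = c₁) (|η|^d∕c₀ ≤ ρ_w) m U (E162's data) εU hεU hUε α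
  (0 ≤ α ≤ α₀) hRS (U(b) ∈ U1) (‖U(b) − 1‖ ≤ αη) (‖U(∂p) − 1‖ ≤ αη²) hεg` (the OWNER's INTENT-5 class VERBATIM) `Δ₁ {θ} (0 ≤ θ ≤ γ₁∕2) (hθ : the N₁-form defect)
  hpos₁ hposU hQ {C_K} (0 ≤ C_K) (hK : ‖(Q_kG_kQ_k†)⁻¹c‖ ≤ C_K‖c‖)`, then for every `b`: `‖H̃b − Hb‖, ‖curl₁(H̃b − Hb)‖, ‖div₁(H̃b − Hb)‖ ≤ C·√C_K·θ·‖b‖`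
  with `H̃ = H1LatticeK hpos₁ hQ` (the slot's minimiser), `H = H1LatticeK hposU hQ` (the chain's `H_{1,k}(U)`), `C = (γ₁∕2)⁻¹·(γ₁′)^{−1∕2}`.
HONEST SCOPE.  [folklore]; θ and `C_K` DISPLAYED (θ is inhabited for print's slot by `B9Eq3120DeltaPiPrimeFormDiagonalClosed` ∕ `…TwoWindows`, `C_K` by the chain's
K-floor files); the windows, E162's data, `hRS`, `ρ_w`, the profile and the witnesses stay HYPOTHESES; FIRST order, energy currency on the diagonal only — no kernel
bound, no decay, NOT the (N)-reading, not the `𝔊`-row (sequel `B9Eq3153FrakGkLipschitzSlotDiagonal`).  «NE9 ⇐ the named binders»; NE9 NOT PRINTED ∕ NOT PROVED; NOT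
summit progress (cell pub-balaban: row NE9 WALLED ON A MODEL (O-NE9-1; #5 UNRULED); spine PROVED 0/9; rung (B)+1 finite T⁴ — NOT infinite volume, NOT mass gap, NOT
BetaPertH, NOT Clay; HONEST DEPENDENCY: continuum YM on T⁴ ⇐ BetaPertH ∧ nine spine estimates (0/9 proved); BetaPertH ⇐ (D1) ∧ (D4) ∧ CAP+tail; G-an2-4 gates asym,
D1 and NE2/3/4).  NEW file; nothing modified.  Net new unproved facts: 0.
-/

noncomputable section

open scoped InnerProductSpace ComplexConjugate BigOperators

namespace Literature.MathematicalPhysics.QuantumFieldTheory.Balaban1983to89.B9Eq3126H1kLipschitzSlotDiagonal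

open B4Sect5Torus (TSite)
open B9SectCLatticeCarrier (Bond)
open B11Eq103H1Complex (SiteL2K BondL2K covDerivL2K covDivL2K laplaceALatticeK laplaceAK laplaceAK_apply H1LatticeK KinvLatticeK H1K KinvK
  adjoint_injective_of_surjective)
open B9Eq310HessianOperator (adTransportW hessOp covCurlL2K)
open B9Eq310DeltaPrime (plaqHolU)
open B9Eq315QTorus (perCfg cornerSite)
open B9Eq315QTower (towerP UlevOf)
open B9Eq326OperatorTower (laplaceAk QkW RofUk)
open B7Prop1Explicit (U1 Wcx boxVec)
open B9Eq3153FrakGkBoundDiagonal (exists_energy_letters_diagonal_closed)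
open B9Eq3153FrakGkBoundSlotDiagonal (exists_energy_letters_slot_diagonal_closed)
open B9Eq3126H1LipschitzEnergy (norm_apply_H1K_sub_le)

/-- `x ≤ √S` from `0 ≤ x` and `x² ≤ S`. [folklore] -/
private theorem le_sqrt_of_sq_le {x S : ℝ} (hx : 0 ≤ x) (h : x ^ 2 ≤ S) : x ≤ Real.sqrt S := by
  calc x = Real.sqrt (x ^ 2) := (Real.sqrt_sq hx).symm
    _ ≤ Real.sqrt S := Real.sqrt_le_sqrt h

variable {d : ℕ} (L : ℕ) [NeZero L] (hL : 1 ≤ L)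
  {𝔸 : Type*} [NormedRing 𝔸] [NormedAlgebra ℂ 𝔸] [CompleteSpace 𝔸] [NormOneClass 𝔸] [StarRing 𝔸] [NormedStarGroup 𝔸] [StarModule ℂ 𝔸]
  {W : Type*} [NormedAddCommGroup W] [InnerProductSpace ℂ W] [FiniteDimensional ℂ W] (φ : W ≃ₗ[ℂ] 𝔸)
  {Mφ Mφ' : ℝ} (hMφ : 0 ≤ Mφ) (hMφ' : 0 ≤ Mφ') (hφ : ∀ w, ‖φ w‖ ≤ Mφ * ‖w‖) (hφ' : ∀ X, ‖φ.symm X‖ ≤ Mφ' * ‖X‖)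
  {a : ℝ} (ha : 0 < a) {r : ℝ} (hr0 : 0 ≤ r) (hr1 : r < 1)
  (τ : 𝔸 →ₗ[ℂ] ℂ) {Cτ : ℝ} (hτ : ∀ X, ‖τ X‖ ≤ Cτ * ‖X‖) (hCτ : 0 ≤ Cτ) {ρw : ℝ} (hρw : 0 ≤ ρw)

include hMφ hMφ' hφ hφ' ha hr0 hr1 hτ hCτ hρw

-- deep definitional unfolding `H1LatticeK`∕`KinvLatticeK` ↦ `H1K`∕`KinvK` (as in `B9Eq3126H1kLipschitzEnergyDiagonal`)
set_option maxRecDepth 8192 in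
/-- **THE MINIMISER OF A HESSIAN-SLOT PERTURBATION AGAINST THE CHAIN's `H_{1,k}(U)`, IN THE FLAT ENERGY NORM, ON THE DIAGONAL** — see the module header:
`∃ α₀ γ₁ C > 0` first; on the OWNER's INTENT-5 class, for every slot `Δ₁` with `N₁`-form defect `θ ≤ γ₁∕2`, ANY witnesses `hpos₁ hposU hQ` and the chain's
`K⁻¹`-letter `C_K` at `U`: `‖P(H̃_{1,k}b − H_{1,k}b)‖ ≤ C·√C_K·θ·‖b‖`, `P ∈ {1, curl₁, div₁}` — `B9Eq3126H1LipschitzEnergy.norm_apply_H1K_sub_le` with `δ_Q = 0`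
(same `Q_k`), `C₁ :=` the operator norm of `K̃⁻¹` (times zero), `γ = γ₁∕2`, `γ₀ = γ₁′`, `Θ = θ`. [folklore]
[cite: Balaban1985BackgroundPropagators, (3.126) p.420, (3.130) p.421, (3.122) p.420, Thm 3.11 p.416, Thm 3.4 p.400; Balaban1985Variational, (45)–(46) p.285] -/
theorem exists_norm_H1k_slot_sub_le_diagonal :
    ∃ α₀ γ₁ C : ℝ, 0 < α₀ ∧ 0 < γ₁ ∧ 0 < C ∧ ∀ (n : ℕ) (η : ℝ), η * (L : ℝ) ^ (n + 1) = 1 →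
      ∀ (c₀ c₁ : ℝ) [Fact (0 < c₀)] [Fact (0 < c₁)], c₀ * ((L : ℝ) ^ (n + 1)) ^ d = c₁ → |η| ^ d / c₀ ≤ ρw →
      ∀ (m : Fin d → ℕ) [∀ i, NeZero (m i)] (U : Bond d (towerP L m (n + 1)) → 𝔸ˣ) (αU : ℕ → ℝ) (hα1 : ∀ j, αU j ≤ 1 / 64)
        (hU1 : ∀ (j : ℕ) (x : B7Prop1Explicit.Site d) (κ : Fin d), perCfg (towerP L m (j + 1)) (UlevOf L m (n + 1) U j) x κ ∈ U1 𝔸)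
        (hreg : ∀ (j : ℕ) (y : TSite d (towerP L m j)) (κ : Fin d) (r : Fin d → Fin L),
          ‖((Wcx L (perCfg (towerP L m (j + 1)) (UlevOf L m (n + 1) U j)) (cornerSite L y) κ (boxVec L r) : 𝔸ˣ) : 𝔸) - 1‖ ≤ αU j)
        (εU : ℕ → ℝ), (∀ j, 0 ≤ εU j) → (∀ (j : ℕ) (b : Bond d (towerP L m (j + 1))), ‖(UlevOf L m (n + 1) U j b : 𝔸) - 1‖ ≤ εU j) →
      ∀ {α : ℝ}, 0 ≤ α → α ≤ α₀ →
        (∀ (b : Bond d (towerP L m (n + 1))) (v u : W), ⟪adTransportW φ U b v, u⟫_ℂ = ⟪v, adTransportW φ (fun b => (U b)⁻¹) b u⟫_ℂ) →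
        (∀ b, U b ∈ U1 𝔸) → (∀ b, ‖(U b : 𝔸) - 1‖ ≤ α * η) →
        (∀ p : B9SectCLatticeCarrier.Plaq d (towerP L m (n + 1)), ‖(plaqHolU U p : 𝔸) - 1‖ ≤ α * η ^ 2) →
        (∀ j < n + 1, εU j ≤ α * r ^ j) →
        ∀ (Δ₁ : BondL2K ℂ d (towerP L m (n + 1)) c₀ W →ₗ[ℂ] BondL2K ℂ d (towerP L m (n + 1)) c₀ W) {θ : ℝ}, 0 ≤ θ → θ ≤ γ₁ / 2 →
        (∀ u v : BondL2K ℂ d (towerP L m (n + 1)) c₀ W, ‖⟪u, Δ₁ v⟫_ℂ - ⟪u, hessOp φ η U τ v⟫_ℂ‖ ≤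
            θ * Real.sqrt (‖covCurlL2K ℂ c₀ ((η : ℂ))⁻¹ (adTransportW φ (fun _ : Bond d (towerP L m (n + 1)) => (1 : 𝔸ˣ))) u‖ ^ 2 +
                  ‖covDivL2K ℂ c₀ ((η : ℂ))⁻¹ (adTransportW φ fun _ : Bond d (towerP L m (n + 1)) => (1 : 𝔸ˣ)⁻¹) u‖ ^ 2 + ‖u‖ ^ 2) *
                Real.sqrt (‖covCurlL2K ℂ c₀ ((η : ℂ))⁻¹ (adTransportW φ (fun _ : Bond d (towerP L m (n + 1)) => (1 : 𝔸ˣ))) v‖ ^ 2 +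
                  ‖covDivL2K ℂ c₀ ((η : ℂ))⁻¹ (adTransportW φ fun _ : Bond d (towerP L m (n + 1)) => (1 : 𝔸ˣ)⁻¹) v‖ ^ 2 + ‖v‖ ^ 2)) →
        ∀ (hpos₁ : ∀ x : BondL2K ℂ d (towerP L m (n + 1)) c₀ W, x ≠ 0 →
            0 < RCLike.re ⟪x, laplaceALatticeK ((η : ℂ))⁻¹ (adTransportW φ U) (adTransportW φ fun b => (U b)⁻¹) Δ₁ (RofUk L m n φ η U)
              (QkW L m n φ U hL αU hα1 hU1 hreg (c₁ := c₁)) a x⟫_ℂ)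
          (hposU : ∀ x : BondL2K ℂ d (towerP L m (n + 1)) c₀ W, x ≠ 0 →
            0 < RCLike.re ⟪x, laplaceAk L m n φ η U hL αU hα1 hU1 hreg τ (c₀ := c₀) (c₁ := c₁) a x⟫_ℂ)
          (hQ : Function.Surjective (QkW L m n φ U hL αU hα1 hU1 hreg (c₀ := c₀) (c₁ := c₁))) {CK : ℝ}, 0 ≤ CK →
        (∀ c : BondL2K ℂ d m c₁ W, ‖KinvLatticeK hposU hQ c‖ ≤ CK * ‖c‖) →
        ∀ b : BondL2K ℂ d m c₁ W,
          ‖H1LatticeK hpos₁ hQ b - H1LatticeK hposU hQ b‖ ≤ C * Real.sqrt CK * θ * ‖b‖ ∧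
          ‖covCurlL2K ℂ c₀ ((η : ℂ))⁻¹ (adTransportW φ (fun _ : Bond d (towerP L m (n + 1)) => (1 : 𝔸ˣ)))
            (H1LatticeK hpos₁ hQ b - H1LatticeK hposU hQ b)‖ ≤ C * Real.sqrt CK * θ * ‖b‖ ∧
          ‖covDivL2K ℂ c₀ ((η : ℂ))⁻¹ (adTransportW φ fun _ : Bond d (towerP L m (n + 1)) => (1 : 𝔸ˣ)⁻¹)
            (H1LatticeK hpos₁ hQ b - H1LatticeK hposU hQ b)‖ ≤ C * Real.sqrt CK * θ * ‖b‖ := by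
  -- the slot letters (`γ₁∕2`-coercivity) and the bare letters (`γ₁′`-coercivity of the chain at `U`)
  obtain ⟨α₁, γ₁, hα₁, hγ₁, HS⟩ := exists_energy_letters_slot_diagonal_closed (d := d) L hL φ hMφ hMφ' hφ hφ' ha hr0 hr1 τ hτ hCτ hρw
  obtain ⟨α₂, γ₀, hα₂, hγ₀, HB⟩ := exists_energy_letters_diagonal_closed (d := d) L hL φ hMφ hMφ' hφ hφ' ha hr0 hr1 τ hτ hCτ hρw
  have hγ2 : 0 < γ₁ / 2 := by positivity
  refine ⟨min α₁ α₂, γ₁, (γ₁ / 2)⁻¹ * (Real.sqrt γ₀)⁻¹, lt_min hα₁ hα₂, hγ₁, by positivity, ?_⟩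
  intro n η hηL c₀ c₁ _ _ hw hρ m _ U αU hα1 hU1 hreg εU hεU hUε α hα0 hαle hRS hUb hUη hpl hεg Δ₁ θ hθ0 hθle hθ hpos₁ hposU hQ CK hCK hK b
  have hαα₁ : α ≤ α₁ := hαle.trans (min_le_left _ _)
  have hαα₂ : α ≤ α₂ := hαle.trans (min_le_right _ _)
  have HSx := HS n η hηL c₀ c₁ hw hρ m U αU hα1 hU1 hreg εU hεU hUε hα0 hαα₁ hRS hUb hUη hpl hεg Δ₁ hθ0 hθle hθ
  have HBx := HB n η hηL c₀ c₁ hw hρ m U αU hα1 hU1 hreg εU hεU hUε hα0 hαα₂ hRS hUb hUη hpl hεg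
  -- the flat energy weight `N₁` (opaque)
  obtain ⟨N, hNdef⟩ : ∃ N : BondL2K ℂ d (towerP L m (n + 1)) c₀ W → ℝ, N = fun z =>
      Real.sqrt (‖covCurlL2K ℂ c₀ ((η : ℂ))⁻¹ (adTransportW φ (fun _ : Bond d (towerP L m (n + 1)) => (1 : 𝔸ˣ))) z‖ ^ 2 +
        ‖covDivL2K ℂ c₀ ((η : ℂ))⁻¹ (adTransportW φ fun _ : Bond d (towerP L m (n + 1)) => (1 : 𝔸ˣ)⁻¹) z‖ ^ 2 + ‖z‖ ^ 2) := ⟨_, rfl⟩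
  have hNz : ∀ z, N z = Real.sqrt (‖covCurlL2K ℂ c₀ ((η : ℂ))⁻¹ (adTransportW φ (fun _ : Bond d (towerP L m (n + 1)) => (1 : 𝔸ˣ))) z‖ ^ 2 +
        ‖covDivL2K ℂ c₀ ((η : ℂ))⁻¹ (adTransportW φ fun _ : Bond d (towerP L m (n + 1)) => (1 : 𝔸ˣ)⁻¹) z‖ ^ 2 + ‖z‖ ^ 2) := fun z => by rw [hNdef]
  have hN0 : ∀ z, 0 ≤ N z := fun z => by rw [hNz]; exact Real.sqrt_nonneg _
  have hNsq : ∀ z, N z ^ 2 = ‖covCurlL2K ℂ c₀ ((η : ℂ))⁻¹ (adTransportW φ (fun _ : Bond d (towerP L m (n + 1)) => (1 : 𝔸ˣ))) z‖ ^ 2 +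
        ‖covDivL2K ℂ c₀ ((η : ℂ))⁻¹ (adTransportW φ fun _ : Bond d (towerP L m (n + 1)) => (1 : 𝔸ˣ)⁻¹) z‖ ^ 2 + ‖z‖ ^ 2 := fun z => by
    rw [hNz]; exact Real.sq_sqrt (add_nonneg (add_nonneg (sq_nonneg _) (sq_nonneg _)) (sq_nonneg _))
  have hNn : ∀ z, ‖z‖ ≤ N z := fun z => by
    rw [hNz]; exact le_sqrt_of_sq_le (norm_nonneg _) (le_add_of_nonneg_left (add_nonneg (sq_nonneg _) (sq_nonneg _)))
  have hNc : ∀ z, ‖covCurlL2K ℂ c₀ ((η : ℂ))⁻¹ (adTransportW φ (fun _ : Bond d (towerP L m (n + 1)) => (1 : 𝔸ˣ))) z‖ ≤ N z := fun z => by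
    rw [hNz]; exact le_sqrt_of_sq_le (norm_nonneg _) ((le_add_of_nonneg_right (sq_nonneg _)).trans (le_add_of_nonneg_right (sq_nonneg _)))
  have hNd : ∀ z, ‖covDivL2K ℂ c₀ ((η : ℂ))⁻¹ (adTransportW φ fun _ : Bond d (towerP L m (n + 1)) => (1 : 𝔸ˣ)⁻¹) z‖ ≤ N z := fun z => by
    rw [hNz]; exact le_sqrt_of_sq_le (norm_nonneg _) ((le_add_of_nonneg_left (sq_nonneg _)).trans (le_add_of_nonneg_right (sq_nonneg _)))
  have hNid : ∀ z : BondL2K ℂ d (towerP L m (n + 1)) c₀ W,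
      ‖(LinearMap.id : BondL2K ℂ d (towerP L m (n + 1)) c₀ W →ₗ[ℂ] BondL2K ℂ d (towerP L m (n + 1)) c₀ W) z‖ ≤ N z := fun z => by
    rw [LinearMap.id_apply]; exact hNn z
  -- the two coercivities in the weight
  have hcoer1 : ∀ z, γ₁ / 2 * N z ^ 2 ≤ RCLike.re ⟪z, laplaceALatticeK ((η : ℂ))⁻¹ (adTransportW φ U) (adTransportW φ fun b => (U b)⁻¹) Δ₁ (RofUk L m n φ η U)
      (QkW L m n φ U hL αU hα1 hU1 hreg (c₁ := c₁)) a z⟫_ℂ := fun z => by rw [hNsq]; exact (HSx z).1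
  have hcoer0 : ∀ z, γ₀ * N z ^ 2 ≤ RCLike.re ⟪z, laplaceAk L m n φ η U hL αU hα1 hU1 hreg τ (c₀ := c₀) (c₁ := c₁) a z⟫_ℂ := fun z => by
    rw [hNsq]; exact (HBx z).1
  -- the form defect in the weight: the two operators differ by the slot only
  have key : ∀ u v : BondL2K ℂ d (towerP L m (n + 1)) c₀ W,
      ⟪u, laplaceALatticeK ((η : ℂ))⁻¹ (adTransportW φ U) (adTransportW φ fun b => (U b)⁻¹) Δ₁ (RofUk L m n φ η U)
          (QkW L m n φ U hL αU hα1 hU1 hreg (c₁ := c₁)) a v⟫_ℂ -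
        ⟪u, laplaceAk L m n φ η U hL αU hα1 hU1 hreg τ (c₀ := c₀) (c₁ := c₁) a v⟫_ℂ = ⟪u, Δ₁ v⟫_ℂ - ⟪u, hessOp φ η U τ v⟫_ℂ := by
    intro u v
    simp only [laplaceAk, laplaceALatticeK, laplaceAK_apply, inner_add_right]
    ring
  have hT : ∀ u v : BondL2K ℂ d (towerP L m (n + 1)) c₀ W,
      ‖⟪u, laplaceALatticeK ((η : ℂ))⁻¹ (adTransportW φ U) (adTransportW φ fun b => (U b)⁻¹) Δ₁ (RofUk L m n φ η U)
          (QkW L m n φ U hL αU hα1 hU1 hreg (c₁ := c₁)) a v⟫_ℂ -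
        ⟪u, laplaceAk L m n φ η U hL αU hα1 hU1 hreg τ (c₀ := c₀) (c₁ := c₁) a v⟫_ℂ‖ ≤ θ * N u * N v := fun u v => by
    rw [key, hNz u, hNz v, mul_assoc]; exact (hθ u v).trans_eq (by ring)
  -- `δ_Q = 0`: the two structures share `Q_k(U)`
  have hQd : ∀ w : BondL2K ℂ d (towerP L m (n + 1)) c₀ W,
      ‖QkW L m n φ U hL αU hα1 hU1 hreg (c₀ := c₀) (c₁ := c₁) w - QkW L m n φ U hL αU hα1 hU1 hreg (c₀ := c₀) (c₁ := c₁) w‖ ≤ 0 * ‖w‖ := fun w => by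
    rw [sub_self, norm_zero, zero_mul]
  -- the `K̃⁻¹`-letter of the slot: its operator norm (it multiplies `δ_Q = 0`)
  obtain ⟨C₁, hC₁, hK₁⟩ : ∃ C₁ : ℝ, 0 ≤ C₁ ∧ ∀ c : BondL2K ℂ d m c₁ W, ‖KinvLatticeK hpos₁ hQ c‖ ≤ C₁ * ‖c‖ := by
    refine ⟨‖LinearMap.toContinuousLinearMap (KinvLatticeK hpos₁ hQ)‖, norm_nonneg _, fun c => ?_⟩
    exact (LinearMap.toContinuousLinearMap (KinvLatticeK hpos₁ hQ)).le_opNorm c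
  -- the structure letters
  have hadj : ∀ (x : BondL2K ℂ d (towerP L m (n + 1)) c₀ W) (z : BondL2K ℂ d m c₁ W),
      ⟪QkW L m n φ U hL αU hα1 hU1 hreg (c₀ := c₀) (c₁ := c₁) x, z⟫_ℂ = ⟪x, LinearMap.adjoint (QkW L m n φ U hL αU hα1 hU1 hreg (c₀ := c₀) (c₁ := c₁)) z⟫_ℂ :=
    fun x z => (LinearMap.adjoint_inner_right _ x z).symm
  have hinj := adjoint_injective_of_surjective _ hQ
  -- the constant: `(θ√(C_K∕γ₀) + 0·C_K)∕(γ₁∕2) + √(C₁∕(γ₁∕2))·(0·√(C_K∕γ₀)) = (γ₁∕2)⁻¹(√γ₀)⁻¹·√C_K·θ`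
  have hCfin : (θ * Real.sqrt (CK / γ₀) + 0 * CK) / (γ₁ / 2) + Real.sqrt (C₁ / (γ₁ / 2)) * (0 * Real.sqrt (CK / γ₀)) =
      (γ₁ / 2)⁻¹ * (Real.sqrt γ₀)⁻¹ * Real.sqrt CK * θ := by
    rw [Real.sqrt_div hCK, zero_mul, zero_mul, add_zero, mul_zero, add_zero]
    field_simp
  -- `B9Eq3126H1LipschitzEnergy` (structure 1 := the slot, structure 0 := the chain at `U`)
  refine ⟨?_, ?_, ?_⟩
  · rw [← hCfin]
    have h := norm_apply_H1K_sub_le (𝕜 := ℂ) hposU hadj hinj hpos₁ hadj hinj N hN0 hNn hγ2 hγ₀ hθ0 le_rfl hCK hC₁ hcoer1 hcoer0 hT hQd hK hK₁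
      (LinearMap.id : BondL2K ℂ d (towerP L m (n + 1)) c₀ W →ₗ[ℂ] BondL2K ℂ d (towerP L m (n + 1)) c₀ W) hNid b
    rw [LinearMap.id_apply] at h
    exact h
  · rw [← hCfin]
    exact norm_apply_H1K_sub_le (𝕜 := ℂ) hposU hadj hinj hpos₁ hadj hinj N hN0 hNn hγ2 hγ₀ hθ0 le_rfl hCK hC₁ hcoer1 hcoer0 hT hQd hK hK₁
      (covCurlL2K ℂ c₀ ((η : ℂ))⁻¹ (adTransportW φ (fun _ : Bond d (towerP L m (n + 1)) => (1 : 𝔸ˣ)))) hNc b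
  · rw [← hCfin]
    exact norm_apply_H1K_sub_le (𝕜 := ℂ) hposU hadj hinj hpos₁ hadj hinj N hN0 hNn hγ2 hγ₀ hθ0 le_rfl hCK hC₁ hcoer1 hcoer0 hT hQd hK hK₁
      (covDivL2K ℂ c₀ ((η : ℂ))⁻¹ (adTransportW φ fun _ : Bond d (towerP L m (n + 1)) => (1 : 𝔸ˣ)⁻¹)) hNd b

end Literature.MathematicalPhysics.QuantumFieldTheory.Balaban1983to89.B9Eq3126H1kLipschitzSlotDiagonal

end
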